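import Mathlib

/-!
# `PolynomialSlack` (stmt-MatrixMultiplication-8306): irreducible representations of `S_n` of degree `> 1`
# are faithful, and faithful commuting involutions need dimension

Helper file 1/3 of the PRINT REGIME `C < 1/2` of the crux `SnSubsetDichotomy.PolynomialSlack`
(`|S||T||U|·n^C ≤ (n!)^{3/2}` for TPP triples of `S_n`; BCGPU 2023 Thm. 3.2 is the tree theorem
`BCGPU2023_thm32_holds`, but the tree has no lower bound for `n(S_n) = secondCharDegree (Perm (Fin n))`).
The bound `⌊n/4⌋ ≤ n(S_n)` is assembled in `SnSubsetDichotomyPolynomialSlackMinDegree.lean` from: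

* `index_fixer_le_two_pow_finrank` — for a commutative group acting linearly by INVOLUTIONS on a
  finite-dimensional complex space, the subgroup fixing an invariant subspace `W` pointwise has index
  `≤ 2 ^ dim W` (split `W` into the `±1`-eigenspaces of a non-scalar element and use
  `[E : K₊ ∩ K₋] ≤ [E : K₊][E : K₋]`);
* `finrank_eq_one_of_isIrreducible_of_commute` — an irreducible representation with pairwise commuting
  operators is one-dimensional (Schur, Mathlib's `algebraMap_intertwiningMap_bijective_of_isAlgClosed`);
* `injective_of_isIrreducible_perm` — for `n ≥ 5` an irreducible representation of `S_n` of degree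
  `> 1` is faithful (a non-trivial normal subgroup of `S_n` contains `A_n`, Mathlib's
  `Equiv.Perm.alternatingGroup_le_of_normal`, and commutators are even).
-/

namespace Summit.MatrixMultiplication.MatrixMultiplication.Theorems.PolynomialSlack

open Module

-- `Summit.<Summit>.<Problem>` is the tree's mandated summit-side namespace (CONVENTIONS §2); for
-- this single-conjunct summit the two coincide, so each declaration silences `dupNamespace`.
set_option linter.dupNamespace false

/-! ## Commuting involutions: the pointwise fixer of an invariant subspace has index `≤ 2 ^ dim` -/

/-- **Index of the pointwise fixer.** Let a commutative group `E` act on a finite-dimensional complex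
vector space `V` by involutions (`τ e ∘ τ e = id`). For every `τ`-invariant subspace `W` the subgroup
of elements fixing `W` pointwise has index at most `2 ^ dim W`. (Induction on `dim W`: if every
element acts on `W` as `±1` the fixer is the kernel of a character to `{±1}`; otherwise split
`W = W₊ ⊕ W₋` along a non-scalar `τ e₀` and use `[E : K₊ ⊓ K₋] ≤ [E : K₊]·[E : K₋]`.) [folklore] -/
theorem index_fixer_le_two_pow_finrank {E V : Type*} [CommGroup E] [AddCommGroup V] [Module ℂ V]
    [FiniteDimensional ℂ V] (τ : E →* Module.End ℂ V) (hinv : ∀ e, τ e * τ e = 1) :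
    ∀ (d : ℕ) (W : Submodule ℂ V), finrank ℂ W = d → (∀ e, ∀ w ∈ W, τ e w ∈ W) →
      ∃ K : Subgroup E, (∀ e, e ∈ K ↔ ∀ w ∈ W, τ e w = w) ∧ K.index ≤ 2 ^ d := by
  intro d
  induction d using Nat.strong_induction_on with
  | _ d ih =>
  intro W hWd hWinv
  -- the pointwise fixer of `W`, as a subgroup
  let K : Subgroup E :=
    { carrier := {e | ∀ w ∈ W, τ e w = w}
      mul_mem' := by
        intro a b ha hb w hw
        simp only [Set.mem_setOf_eq] at ha hb ⊢
        rw [map_mul, Module.End.mul_apply, hb w hw, ha w hw]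
      one_mem' := by
        intro w _
        simp
      inv_mem' := by
        intro a ha w hw
        simp only [Set.mem_setOf_eq] at ha ⊢
        have hinva : τ a⁻¹ = τ a := by
          have h1 : τ a⁻¹ * τ a = 1 := by rw [← map_mul, inv_mul_cancel, map_one]
          calc τ a⁻¹ = τ a⁻¹ * (τ a * τ a) := by rw [hinv a, mul_one]
            _ = (τ a⁻¹ * τ a) * τ a := by rw [mul_assoc]
            _ = τ a := by rw [h1, one_mul]
        rw [hinva, ha w hw] }
  have hKmem : ∀ e, e ∈ K ↔ ∀ w ∈ W, τ e w = w := fun e => Iff.rfl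
  by_cases hscal : ∀ e, (∀ w ∈ W, τ e w = w) ∨ (∀ w ∈ W, τ e w = -w)
  · -- every element acts on `W` as `±1`
    refine ⟨K, hKmem, ?_⟩
    by_cases hW0 : W = ⊥
    · -- `W = 0`: the fixer is everything
      have hK : K = ⊤ := by
        rw [eq_top_iff]
        intro e _ w hw
        rw [hW0, Submodule.mem_bot] at hw
        rw [hw, map_zero]
      rw [hK, Subgroup.index_top]
      exact Nat.one_le_two_pow
    · -- `W ≠ 0`: the fixer has index ≤ 2
      obtain ⟨w₀, hw₀W, hw₀⟩ := (Submodule.ne_bot_iff W).1 hW0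
      have hneg : ∀ e, e ∉ K → ∀ w ∈ W, τ e w = -w := by
        intro e he
        rcases hscal e with h | h
        · exact absurd ((hKmem e).2 h) he
        · exact h
      have hmulK : ∀ a b, a ∉ K → b ∉ K → a * b ∈ K := by
        intro a b ha hb w hw
        rw [map_mul, Module.End.mul_apply, hneg b hb w hw, map_neg, hneg a ha w hw, neg_neg]
      have hidx : K.index ≤ 2 := by
        by_cases hKtop : K = ⊤
        · rw [hKtop, Subgroup.index_top]; norm_num
        · obtain ⟨a, ha⟩ : ∃ a, a ∉ K := by
            by_contra hall
            push Not at hall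
            exact hKtop (eq_top_iff.2 fun e _ => hall e)
          have h2 : K.index = 2 := by
            rw [Subgroup.index_eq_two_iff]
            refine ⟨a, fun b => ?_⟩
            by_cases hb : b ∈ K
            · refine Or.inr ⟨hb, fun hba => ha ?_⟩
              have : b⁻¹ * (b * a) ∈ K := K.mul_mem (K.inv_mem hb) hba
              simpa using this
            · exact Or.inl ⟨hmulK b a hb ha, hb⟩
          rw [h2]
      calc K.index ≤ 2 := hidx
        _ = 2 ^ 1 := by norm_num
        _ ≤ 2 ^ d := by
            apply Nat.pow_le_pow_right (by norm_num)
            rw [← hWd]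
            have : finrank ℂ W ≠ 0 := fun h0 => hW0 (Submodule.finrank_eq_zero.1 h0)
            omega
  · -- a non-scalar element `e₀`: split `W` into its `±1` eigenspaces
    push Not at hscal
    obtain ⟨e₀, ⟨wp, hwpW, hwp⟩, ⟨wm, hwmW, hwm⟩⟩ := hscal
    let Wp : Submodule ℂ V := W ⊓ LinearMap.ker (τ e₀ - 1)
    let Wm : Submodule ℂ V := W ⊓ LinearMap.ker (τ e₀ + 1)
    have memWp : ∀ w, w ∈ Wp ↔ w ∈ W ∧ τ e₀ w = w := by
      intro w
      simp only [Wp, Submodule.mem_inf, LinearMap.mem_ker, LinearMap.sub_apply, Module.End.one_apply,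
        sub_eq_zero]
    have memWm : ∀ w, w ∈ Wm ↔ w ∈ W ∧ τ e₀ w = -w := by
      intro w
      simp only [Wm, Submodule.mem_inf, LinearMap.mem_ker, LinearMap.add_apply, Module.End.one_apply,
        add_eq_zero_iff_eq_neg]
    -- commutation and the involution property, pointwise
    have hcomm : ∀ a b (v : V), τ a (τ b v) = τ b (τ a v) := by
      intro a b v
      change (τ a * τ b) v = (τ b * τ a) v
      rw [← map_mul, ← map_mul, mul_comm]
    have hsq : ∀ a (v : V), τ a (τ a v) = v := by
      intro a v
      change (τ a * τ a) v = v
      rw [hinv a, Module.End.one_apply]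
    -- invariance of `Wp`, `Wm`
    have hWpinv : ∀ e, ∀ w ∈ Wp, τ e w ∈ Wp := by
      intro e w hw
      rw [memWp] at hw ⊢
      exact ⟨hWinv e w hw.1, by rw [hcomm, hw.2]⟩
    have hWminv : ∀ e, ∀ w ∈ Wm, τ e w ∈ Wm := by
      intro e w hw
      rw [memWm] at hw ⊢
      exact ⟨hWinv e w hw.1, by rw [hcomm, hw.2, map_neg]⟩
    -- `Wp ⊓ Wm = ⊥` and `Wp ⊔ Wm = W`
    have hinf : Wp ⊓ Wm = ⊥ := by
      rw [eq_bot_iff]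
      intro w hw
      rw [Submodule.mem_inf, memWp, memWm] at hw
      rw [Submodule.mem_bot]
      have h2 : (2 : ℂ) • w = 0 := by
        rw [two_smul]
        nth_rewrite 2 [← hw.1.2]
        rw [hw.2.2, add_neg_cancel]
      rcases smul_eq_zero.1 h2 with h | h
      · norm_num at h
      · exact h
    have hsup : Wp ⊔ Wm = W := by
      apply le_antisymm
      · exact sup_le (fun w hw => ((memWp w).1 hw).1) (fun w hw => ((memWm w).1 hw).1)
      · intro w hw
        have he₀w : τ e₀ w ∈ W := hWinv e₀ w hw
        have hp : (2 : ℂ)⁻¹ • (w + τ e₀ w) ∈ Wp := by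
          rw [memWp]
          refine ⟨W.smul_mem _ (W.add_mem hw he₀w), ?_⟩
          rw [map_smul, map_add, hsq, add_comm]
        have hm : (2 : ℂ)⁻¹ • (w - τ e₀ w) ∈ Wm := by
          rw [memWm]
          refine ⟨W.smul_mem _ (W.sub_mem hw he₀w), ?_⟩
          rw [map_smul, map_sub, hsq, ← smul_neg, neg_sub]
        have hdec : w = (2 : ℂ)⁻¹ • (w + τ e₀ w) + (2 : ℂ)⁻¹ • (w - τ e₀ w) := by
          rw [← smul_add]
          have : w + τ e₀ w + (w - τ e₀ w) = (2 : ℂ) • w := by rw [two_smul]; abel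
          rw [this, smul_smul]
          norm_num
        rw [hdec]
        exact Submodule.add_mem_sup hp hm
    -- dimensions
    have hdim : finrank ℂ Wp + finrank ℂ Wm = d := by
      have h := Submodule.finrank_sup_add_finrank_inf_eq Wp Wm
      rw [hinf, hsup, finrank_bot, add_zero, hWd] at h
      exact h.symm
    have hWp_ne : Wp ≠ ⊥ := by
      intro h0
      apply hwm
      have : wm ∈ Wp ⊔ Wm := by rw [hsup]; exact hwmW
      rw [h0, bot_sup_eq, memWm] at this
      exact this.2
    have hWm_ne : Wm ≠ ⊥ := by
      intro h0
      apply hwp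
      have : wp ∈ Wp ⊔ Wm := by rw [hsup]; exact hwpW
      rw [h0, sup_bot_eq, memWp] at this
      exact this.2
    have hposp : 0 < finrank ℂ Wp :=
      Nat.pos_of_ne_zero fun h0 => hWp_ne (Submodule.finrank_eq_zero.1 h0)
    have hposm : 0 < finrank ℂ Wm :=
      Nat.pos_of_ne_zero fun h0 => hWm_ne (Submodule.finrank_eq_zero.1 h0)
    obtain ⟨Kp, hKp, hKpidx⟩ := ih (finrank ℂ Wp) (by omega) Wp rfl hWpinv
    obtain ⟨Km, hKm, hKmidx⟩ := ih (finrank ℂ Wm) (by omega) Wm rfl hWminv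
    refine ⟨Kp ⊓ Km, fun e => ?_, ?_⟩
    · rw [Subgroup.mem_inf, hKp, hKm]
      constructor
      · rintro ⟨hp, hm⟩ w hw
        have : w ∈ Wp ⊔ Wm := by rw [hsup]; exact hw
        obtain ⟨wp, hwp, wm, hwm, rfl⟩ := Submodule.mem_sup.1 this
        rw [map_add, hp wp hwp, hm wm hwm]
      · intro h
        exact ⟨fun w hw => h w ((memWp w).1 hw).1, fun w hw => h w ((memWm w).1 hw).1⟩
    · calc (Kp ⊓ Km).index ≤ Kp.index * Km.index := Subgroup.index_inf_le
        _ ≤ 2 ^ finrank ℂ Wp * 2 ^ finrank ℂ Wm := Nat.mul_le_mul hKpidx hKmidx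
        _ = 2 ^ d := by rw [← pow_add, hdim]

/-! ## Irreducible representations with commuting operators are one-dimensional -/

/-- **Schur.** A finite-dimensional irreducible complex representation all of whose operators commute
pairwise is one-dimensional: each `ρ g` is then an intertwining operator, hence a scalar (Mathlib's
`Representation.IsIrreducible.algebraMap_intertwiningMap_bijective_of_isAlgClosed`), so the span of
any non-zero vector is a subrepresentation. [folklore] -/
theorem finrank_eq_one_of_isIrreducible_of_commute {G V : Type} [Group G] [AddCommGroup V]
    [Module ℂ V] [FiniteDimensional ℂ V] (ρ : Representation ℂ G V) (hρ : ρ.IsIrreducible)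
    (hcomm : ∀ g h : G, ρ g * ρ h = ρ h * ρ g) : finrank ℂ V = 1 := by
  haveI := hρ
  -- each operator is a scalar
  have hscal : ∀ g : G, ∃ t : ℂ, ∀ v, ρ g v = t • v := by
    intro g
    let f : ρ.IntertwiningMap ρ :=
      LinearMap.intertwiningMap_of_isIntertwiningMap (ρ := ρ) (σ := ρ) (f := ρ g) (fun h v => by
        change (ρ g * ρ h) v = (ρ h * ρ g) v
        rw [hcomm g h])
    obtain ⟨t, ht⟩ :=
      (Representation.IsIrreducible.algebraMap_intertwiningMap_bijective_of_isAlgClosed (ρ := ρ)).2 f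
    refine ⟨t, fun v => ?_⟩
    have h := congrArg (fun φ : ρ.IntertwiningMap ρ => φ v) ht
    simp only [Representation.IntertwiningMap.algebraMap_apply,
      Representation.IntertwiningMap.smul_apply, Representation.IntertwiningMap.coe_one, id] at h
    rw [h]
    rfl
  -- `V` is non-trivial
  haveI : Nontrivial (Subrepresentation ρ) := hρ.toNontrivial
  have hne : (⊥ : Subrepresentation ρ) ≠ ⊤ := bot_ne_top
  haveI : Nontrivial V := by
    by_contra htriv
    rw [not_nontrivial_iff_subsingleton] at htriv
    exact hne (Subrepresentation.toSubmodule_injective (Subsingleton.elim _ _))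
  obtain ⟨v, hv⟩ := exists_ne (0 : V)
  -- the line through `v` is a subrepresentation
  let L : Subrepresentation ρ :=
    ⟨Submodule.span ℂ {v}, fun g w hw => by
      obtain ⟨t, ht⟩ := hscal g
      rw [ht]
      exact Submodule.smul_mem _ _ hw⟩
  rcases eq_bot_or_eq_top L with h | h
  · exfalso
    have hvL : v ∈ L.toSubmodule := Submodule.mem_span_singleton_self v
    have : L.toSubmodule = ⊥ := congrArg Subrepresentation.toSubmodule h
    rw [this, Submodule.mem_bot] at hvL
    exact hv hvL
  · rw [finrank_eq_one_iff_of_nonzero v hv]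
    exact congrArg Subrepresentation.toSubmodule h

/-! ## Irreducible representations of `S_n` of degree `> 1` are faithful (`n ≥ 5`) -/

/-- For `n ≥ 5`, an irreducible complex representation of `S_n = Perm (Fin n)` of dimension `> 1` is
injective: its kernel is a normal subgroup of `S_n`, so if non-trivial it contains `A_n` (Mathlib's
`Equiv.Perm.alternatingGroup_le_of_normal`), whence all commutators act trivially, the operators
commute, and the representation is one-dimensional by Schur. [folklore] -/
theorem injective_of_isIrreducible_perm {n : ℕ} (hn : 5 ≤ n) {V : Type} [AddCommGroup V]
    [Module ℂ V] [FiniteDimensional ℂ V] (ρ : Representation ℂ (Equiv.Perm (Fin n)) V)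
    (hρ : ρ.IsIrreducible) (hd : 1 < finrank ℂ V) : Function.Injective ρ := by
  by_contra hinj
  have hker : ρ.ker ≠ ⊥ := by
    intro h
    exact hinj ((MonoidHom.ker_eq_bot_iff ρ).1 h)
  have hnt : Nontrivial ρ.ker := (Subgroup.nontrivial_iff_ne_bot _).2 hker
  have hcard : 5 ≤ Nat.card (Fin n) := by simpa using hn
  have hA : alternatingGroup (Fin n) ≤ ρ.ker := Equiv.Perm.alternatingGroup_le_of_normal hcard hnt
  have hcomm : ∀ g h : Equiv.Perm (Fin n), ρ g * ρ h = ρ h * ρ g := by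
    intro g h
    have hmem : g * h * g⁻¹ * h⁻¹ ∈ alternatingGroup (Fin n) := by
      rw [Equiv.Perm.mem_alternatingGroup]
      simp only [map_mul, map_inv, mul_inv_cancel_comm, mul_inv_cancel]
    have hone : ρ (g * h * g⁻¹ * h⁻¹) = 1 := (MonoidHom.mem_ker).1 (hA hmem)
    calc ρ g * ρ h = ρ (g * h) := (map_mul ρ g h).symm
      _ = ρ ((g * h * g⁻¹ * h⁻¹) * (h * g)) := by congr 1; group
      _ = ρ (g * h * g⁻¹ * h⁻¹) * ρ (h * g) := map_mul ρ _ _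
      _ = ρ h * ρ g := by rw [hone, one_mul, map_mul]
  have h1 := finrank_eq_one_of_isIrreducible_of_commute ρ hρ hcomm
  omega

end Summit.MatrixMultiplication.MatrixMultiplication.Theorems.PolynomialSlack
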